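import Mathlib
import HarnessLib
import Summits.NavierStokesRegularity.NavierStokesRegularity.Theorems.PoloidalWindowDoorLrcModEntireTwistingTHLocalComoving
import Summits.NavierStokesRegularity.NavierStokesRegularity.Theorems.PoloidalWindowDoorLrcModEntireTHCertGaugeComoving
import Summits.NavierStokesRegularity.NavierStokesRegularity.Theorems.PoloidalWindowDoorLrcModEntireTHCertSliceGaugeUD8T

/-!
# Route `PoloidalWindowDoor`, item `LrcModEntire` (stmt-NavierStokesRegularity-20428) — the CO-MOVING gauge in the time-jet slice letters `UD8T`:
# point-zero letters for ALL time jets of `w₀₀, f₁₀, f₀₁`, and the registered stub BY NAME from one co-moving-gauged leaf / chain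

Cell ns-regularity-ideate, seat ns-k2-port-2 g2 (kernel-port lineage under the LEAD of item 20428, ns-poloidal-K2-p3 g11; `--supports stmt-NavierStokesRegularity-20428`).
Composition of `…TwistingTHLocalComoving.localTHEmptyHypNUGRS_of_comoving` (the registered statement may assume the rest worldline — analytic particle path),
`…THCertGaugeComoving.thLocalDatumZC / thLocalDatumZVC` (the worldline kills every time jet `∂ₜ^τ u_i(p₀)`) and the dictionary `…THCertSliceUD8T` (264 letters).
THE CO-MOVING ZERO LETTERS in the slice currency (KERNEL-CERT-FORMAT-g8 §1 indices + the UD8T extension): Galilean `Rw_0_0, Rf_1_0, If_1_0` = `0, 45, 46`;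
first time jets `Rwt_0_0, Rft_1_0, Ift_1_0` = `99, 127, 128`; second `Rwtt_0_0, Rftt_1_0, Iftt_1_0` = `196, 211, 212`; third `Rwttt_0_0, Rfttt_1_0, Ifttt_1_0` =
`242, 248, 249` — this IS the LEAD's frame row `G0 = [ψ]₀₀ = 0` and its derivatives `D(G0), D²(G0)` together with `ḟ₁₀ = ḟ₀₁ = 0` (DYNAMIC-ROWS-g11 §2), as
point data; RS adds the zero `Rw_1_0` (`1`) and the value `Iw_1_0 = −1/2` (`2`).

* `sliceGaugeZerosC`, `sliceGaugeZerosRSC` and their transfer checks (`decide` / `decide +kernel`);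
* `thSliceLocalDatumZC` / `thSliceLocalDatumZVC` — the gauged data in the 264 slice letters from the registered hypotheses + the rest worldline;
* **`localTHEmptyHypNUGRS_of_sliceLeafZC` / `…LeafZVC` / `…ChainZC` / `…ChainZVC` — THE REGISTERED v4.3/v5 `stub_localTHEmptyHypNUGRS` VERBATIM (no extra hypothesis)
  from ONE leaf / split-free chain in the UD8T tables gauged by the CO-MOVING zero letters** (the worldline hypothesis is discharged inside by the boost).
So an engine certificate «`pins^e ∈ ⟨E′-words incl. direction t⟩ + ⟨w₀₀, f₁₀, f₀₁, their t-, tt-, ttt-jets (, Re w₁₀, Im w₁₀ + ½)⟩`» — i.e. a certificate computed in the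
LEAD's co-moving (RS) frame with the free letters `p, q, b` read as `ft_d0, mtt_j, at_j` — closes S0 by name.
WHAT THIS IS NOT: not a claim about Navier–Stokes and not a certificate — plumbing; no leaf/chain with a `true` check is known. [folklore]
-/

noncomputable section

set_option maxRecDepth 100000

-- the summit and its single sub-problem share the name (CONVENTIONS §1), as in every Theorems file
set_option linter.dupNamespace false

namespace Summit.NavierStokesRegularity.NavierStokesRegularity.Theorems.PoloidalWindowDoorLrcModEntireTHCertSliceGaugeUD8TC

open _root_.Topology _root_.Filter Set Function
open scoped InnerProductSpace Laplacian
open Literature.Analysis.ValidatedNumerics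
open Summit.NavierStokesRegularity.NavierStokesRegularity.Theorems.PoloidalWindowDoorLrcModEntireJetCertDefs
open Summit.NavierStokesRegularity.NavierStokesRegularity.Theorems.PoloidalWindowDoorLrcModEntireJetCertTree
open Summit.NavierStokesRegularity.NavierStokesRegularity.Theorems.PoloidalWindowDoorLrcModEntireJetCertFast2
open Summit.NavierStokesRegularity.NavierStokesRegularity.Theorems.PoloidalWindowDoorLrcModEntireJetCertRelabel
open Summit.NavierStokesRegularity.NavierStokesRegularity.Theorems.PoloidalWindowDoorLrcModEntireJetCertGauge
open Summit.NavierStokesRegularity.NavierStokesRegularity.Theorems.PoloidalWindowDoorLrcModEntireJetCertGaugeV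
open Summit.NavierStokesRegularity.NavierStokesRegularity.Theorems.PoloidalWindowDoorLrcModEntireJetCertGaugeCancel
open Summit.NavierStokesRegularity.NavierStokesRegularity.Theorems.PoloidalWindowDoorLrcModEntireJetCertGaugeVCancel
open Summit.NavierStokesRegularity.NavierStokesRegularity.Theorems.PoloidalWindowDoorLrcModEntireTHCertLetters
open Summit.NavierStokesRegularity.NavierStokesRegularity.Theorems.PoloidalWindowDoorLrcModEntireTHCert
open Summit.NavierStokesRegularity.NavierStokesRegularity.Theorems.PoloidalWindowDoorLrcModEntireTHCertSteady
open Summit.NavierStokesRegularity.NavierStokesRegularity.Theorems.PoloidalWindowDoorLrcModEntireTHCertGauge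
open Summit.NavierStokesRegularity.NavierStokesRegularity.Theorems.PoloidalWindowDoorLrcModEntireTHCertGaugeRS
open Summit.NavierStokesRegularity.NavierStokesRegularity.Theorems.PoloidalWindowDoorLrcModEntireTHCertGaugeComoving
open Summit.NavierStokesRegularity.NavierStokesRegularity.Theorems.PoloidalWindowDoorLrcModEntireTwistingTHLocalComoving
open Summit.NavierStokesRegularity.NavierStokesRegularity.Theorems.PoloidalWindowDoorLrcModEntireTHCertSliceUD8TData
open Summit.NavierStokesRegularity.NavierStokesRegularity.Theorems.PoloidalWindowDoorLrcModEntireTHCertSliceUD8T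
open Summit.NavierStokesRegularity.NavierStokesRegularity.Theorems.PoloidalWindowDoorLrcModEntireTHCertSliceGaugeUD8T

/-! ### The co-moving zero letters and their transfer checks -/

/-- Galilean + co-moving zero letters: `Rw_0_0, Rf_1_0, If_1_0` and their `t`, `tt`, `ttt` jets. [folklore] -/
def sliceGaugeZerosC : List ℕ := [0, 45, 46, 99, 127, 128, 196, 211, 212, 242, 248, 249]

/-- RS + co-moving zero letters: the same with `Rw_1_0` (index `1`). [folklore] -/
def sliceGaugeZerosRSC : List ℕ := [0, 45, 46, 1, 99, 127, 128, 196, 211, 212, 242, 248, 249]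

/-- Transfer of the co-moving zeros: each new zero letter is a multiple of ONE Cartesian letter `W i τ 0 0 0` (`w⁽τ⁾₀₀ = ∂ₜ^τu₂`, `f⁽τ⁾₁₀ = (∂ₜ^τu₀ − i∂ₜ^τu₁)/2`). [folklore] -/
theorem sliceZerosC_check : zerosCheck sliceLetters.length sliceRelabel (gaugeZerosC sliceLetters) sliceGaugeZerosC = true := by
  decide

/-- The same with the RS zero `Rw_1_0 = ∂₀u₂/2`. [folklore] -/
theorem sliceZerosRSC_check : zerosCheck sliceLetters.length sliceRelabel (gaugeZerosRSC sliceLetters) sliceGaugeZerosRSC = true := by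
  decide

/-- The RS value letter `Iw_1_0 = −1/2` against the enlarged zero list. [folklore] -/
theorem sliceValsRSC_check :
    valsCheckD sliceLetters.length sliceRelabel (gaugeZerosRSC sliceLetters) (gaugeValsRS sliceLetters) sliceGaugeValsRS = true := by
  decide +kernel

/-! ### The gauged data -/

/-- **THE CO-MOVING GALILEAN-GAUGED (TH) DATUM IN THE TIME-JET SLICE LETTERS** (registered hypotheses + rest worldline; sign and RS unused). [folklore] -/
theorem thSliceLocalDatumZC
    {u : ℝ → EuclideanSpace ℝ (Fin 3) → EuclideanSpace ℝ (Fin 3)} {μ A : ℝ → ℝ → ℝ}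
    {U : Set (ℝ × EuclideanSpace ℝ (Fin 3))} {p₀ : ℝ × EuclideanSpace ℝ (Fin 3)} (hU : IsOpen U) (hp₀ : p₀ ∈ U)
    (hu : AnalyticOnNhd ℝ (Function.uncurry u) U)
    (hμ : ∀ p ∈ U, AnalyticAt ℝ (Function.uncurry μ) (p.1, p.2 2)) (hA : ∀ p ∈ U, AnalyticAt ℝ (Function.uncurry A) (p.1, p.2 2))
    (hpol : ∀ p ∈ U, fderiv ℝ (u p.1) p.2 (EuclideanSpace.single 0 1) 1 = fderiv ℝ (u p.1) p.2 (EuclideanSpace.single 1 1) 0)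
    (hdiv : ∀ p ∈ U, fderiv ℝ (u p.1) p.2 (EuclideanSpace.single 0 1) 0 + fderiv ℝ (u p.1) p.2 (EuclideanSpace.single 1 1) 1 +
      fderiv ℝ (u p.1) p.2 (EuclideanSpace.single 2 1) 2 = 0)
    (hsh : ∀ p ∈ U, ∀ b : Fin 3, b ≠ 2 →
      fderiv ℝ (u p.1) p.2 (EuclideanSpace.single 2 1) b = μ p.1 (p.2 2) * fderiv ℝ (u p.1) p.2 (EuclideanSpace.single b 1) 2)
    (hE : ∀ p ∈ U,
      (1 - μ p.1 (p.2 2)) *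
          (deriv (fun s => u s p.2 2) p.1 + fderiv ℝ (fun y => u p.1 y 2) p.2 (u p.1 p.2) - Δ (fun y => u p.1 y 2) p.2) =
        A p.1 (p.2 2) + (deriv (fun s => μ s (p.2 2)) p.1 - deriv (deriv (μ p.1)) (p.2 2)) * u p.1 p.2 2
          + deriv (μ p.1) (p.2 2) / 2 * u p.1 p.2 2 ^ 2 - 2 * deriv (μ p.1) (p.2 2) * fderiv ℝ (u p.1) p.2 (EuclideanSpace.single 2 1) 2)
    (htw : fderiv ℝ (fun y => fderiv ℝ (u p₀.1) y (EuclideanSpace.single 2 1) 2) p₀.2 (EuclideanSpace.single 0 1) *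
            fderiv ℝ (u p₀.1) p₀.2 (EuclideanSpace.single 1 1) 2 -
          fderiv ℝ (fun y => fderiv ℝ (u p₀.1) y (EuclideanSpace.single 2 1) 2) p₀.2 (EuclideanSpace.single 1 1) *
            fderiv ℝ (u p₀.1) p₀.2 (EuclideanSpace.single 0 1) 2 ≠ 0)
    (hm0 : μ p₀.1 (p₀.2 2) ≠ 0) (hm1 : μ p₀.1 (p₀.2 2) ≠ 1) (hmz : deriv (μ p₀.1) (p₀.2 2) ≠ 0)
    (hNU : fderiv ℝ (u p₀.1) p₀.2 (EuclideanSpace.single 0 1) 0 ≠ fderiv ℝ (u p₀.1) p₀.2 (EuclideanSpace.single 1 1) 1 ∨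
      fderiv ℝ (u p₀.1) p₀.2 (EuclideanSpace.single 1 1) 0 ≠ 0)
    (hrest : u p₀.1 p₀.2 = 0)
    (hline : ∀ᶠ s in 𝓝 p₀.1, u s p₀.2 = 0) :
    LocalDatumZ (E := ℝ × EuclideanSpace ℝ (Fin 3)) sliceRelabel.m sliceRelabel.Sf sliceRelabel.Mf dirVec sliceRelabel.hyps' sliceRelabel.pins'
      sliceGaugeZerosC :=
  LocalDatumZ.relabel sliceRelabel sliceGaugeZerosC sliceRelabel_check sliceZerosC_check
    (thLocalDatumZC sliceLetters sliceLetters_ok hU hp₀ hu hμ hA hpol hdiv hsh hE htw hm0 hm1 hmz hNU hrest hline)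

/-- **THE CO-MOVING RS-GAUGED (TH) DATUM IN THE TIME-JET SLICE LETTERS** (registered hypotheses + rest worldline; sign unused). [folklore] -/
theorem thSliceLocalDatumZVC
    {u : ℝ → EuclideanSpace ℝ (Fin 3) → EuclideanSpace ℝ (Fin 3)} {μ A : ℝ → ℝ → ℝ}
    {U : Set (ℝ × EuclideanSpace ℝ (Fin 3))} {p₀ : ℝ × EuclideanSpace ℝ (Fin 3)} (hU : IsOpen U) (hp₀ : p₀ ∈ U)
    (hu : AnalyticOnNhd ℝ (Function.uncurry u) U)
    (hμ : ∀ p ∈ U, AnalyticAt ℝ (Function.uncurry μ) (p.1, p.2 2)) (hA : ∀ p ∈ U, AnalyticAt ℝ (Function.uncurry A) (p.1, p.2 2))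
    (hpol : ∀ p ∈ U, fderiv ℝ (u p.1) p.2 (EuclideanSpace.single 0 1) 1 = fderiv ℝ (u p.1) p.2 (EuclideanSpace.single 1 1) 0)
    (hdiv : ∀ p ∈ U, fderiv ℝ (u p.1) p.2 (EuclideanSpace.single 0 1) 0 + fderiv ℝ (u p.1) p.2 (EuclideanSpace.single 1 1) 1 +
      fderiv ℝ (u p.1) p.2 (EuclideanSpace.single 2 1) 2 = 0)
    (hsh : ∀ p ∈ U, ∀ b : Fin 3, b ≠ 2 →
      fderiv ℝ (u p.1) p.2 (EuclideanSpace.single 2 1) b = μ p.1 (p.2 2) * fderiv ℝ (u p.1) p.2 (EuclideanSpace.single b 1) 2)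
    (hE : ∀ p ∈ U,
      (1 - μ p.1 (p.2 2)) *
          (deriv (fun s => u s p.2 2) p.1 + fderiv ℝ (fun y => u p.1 y 2) p.2 (u p.1 p.2) - Δ (fun y => u p.1 y 2) p.2) =
        A p.1 (p.2 2) + (deriv (fun s => μ s (p.2 2)) p.1 - deriv (deriv (μ p.1)) (p.2 2)) * u p.1 p.2 2
          + deriv (μ p.1) (p.2 2) / 2 * u p.1 p.2 2 ^ 2 - 2 * deriv (μ p.1) (p.2 2) * fderiv ℝ (u p.1) p.2 (EuclideanSpace.single 2 1) 2)
    (htw : fderiv ℝ (fun y => fderiv ℝ (u p₀.1) y (EuclideanSpace.single 2 1) 2) p₀.2 (EuclideanSpace.single 0 1) *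
            fderiv ℝ (u p₀.1) p₀.2 (EuclideanSpace.single 1 1) 2 -
          fderiv ℝ (fun y => fderiv ℝ (u p₀.1) y (EuclideanSpace.single 2 1) 2) p₀.2 (EuclideanSpace.single 1 1) *
            fderiv ℝ (u p₀.1) p₀.2 (EuclideanSpace.single 0 1) 2 ≠ 0)
    (hm0 : μ p₀.1 (p₀.2 2) ≠ 0) (hm1 : μ p₀.1 (p₀.2 2) ≠ 1) (hmz : deriv (μ p₀.1) (p₀.2 2) ≠ 0)
    (hNU : fderiv ℝ (u p₀.1) p₀.2 (EuclideanSpace.single 0 1) 0 ≠ fderiv ℝ (u p₀.1) p₀.2 (EuclideanSpace.single 1 1) 1 ∨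
      fderiv ℝ (u p₀.1) p₀.2 (EuclideanSpace.single 1 1) 0 ≠ 0)
    (hrest : u p₀.1 p₀.2 = 0)
    (hx0 : fderiv ℝ (u p₀.1) p₀.2 (EuclideanSpace.single 0 1) 2 = 0)
    (hy1 : fderiv ℝ (u p₀.1) p₀.2 (EuclideanSpace.single 1 1) 2 = 1)
    (hline : ∀ᶠ s in 𝓝 p₀.1, u s p₀.2 = 0) :
    LocalDatumZV (E := ℝ × EuclideanSpace ℝ (Fin 3)) sliceRelabel.m sliceRelabel.Sf sliceRelabel.Mf dirVec sliceRelabel.hyps' sliceRelabel.pins'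
      sliceGaugeZerosRSC sliceGaugeValsRS :=
  LocalDatumZV.relabelD sliceRelabel sliceGaugeZerosRSC sliceGaugeValsRS sliceRelabel_check sliceZerosRSC_check sliceValsRSC_check
    (thLocalDatumZVC sliceLetters sliceLetters_ok hU hp₀ hu hμ hA hpol hdiv hsh hE htw hm0 hm1 hmz hNU hrest hx0 hy1 hline)

/-! ### The registered stub by name, from certificates gauged in the co-moving frame -/

/-- **`stub_localTHEmptyHypNUGRS` (twist_split v4.3/v5, VERBATIM) FROM ONE LEAF GAUGED BY THE CO-MOVING GALILEAN ZEROS** in the UD8T tables: law `k` of the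
derivation `steps` from `E'` equals `twist^e₀·μ^e₁·(μ−1)^e₂·μ_z^e₃·Π_NU^e₄` up to terms containing one of the letters `sliceGaugeZerosC`. [folklore] -/
theorem localTHEmptyHypNUGRS_of_sliceLeafZC (steps : List (List (QMvPoly × ℕ × List ℕ))) (k : ℕ) (e : List ℕ)
    (hcheck : leafCheckZ sliceRelabel.m sliceRelabel.Sf sliceRelabel.Mf sliceRelabel.hyps' sliceRelabel.pins' sliceGaugeZerosC steps k e = true) :
    ∀ (u : ℝ → EuclideanSpace ℝ (Fin 3) → EuclideanSpace ℝ (Fin 3)) (μ A : ℝ → ℝ → ℝ)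
      (U : Set (ℝ × EuclideanSpace ℝ (Fin 3))) (p₀ : ℝ × EuclideanSpace ℝ (Fin 3)),
      IsOpen U → p₀ ∈ U → AnalyticOnNhd ℝ (Function.uncurry u) U →
      (∀ p ∈ U, AnalyticAt ℝ (Function.uncurry μ) (p.1, p.2 2)) → (∀ p ∈ U, AnalyticAt ℝ (Function.uncurry A) (p.1, p.2 2)) →
      (∀ p ∈ U, fderiv ℝ (u p.1) p.2 (EuclideanSpace.single 0 1) 1 = fderiv ℝ (u p.1) p.2 (EuclideanSpace.single 1 1) 0) →
      (∀ p ∈ U, fderiv ℝ (u p.1) p.2 (EuclideanSpace.single 0 1) 0 + fderiv ℝ (u p.1) p.2 (EuclideanSpace.single 1 1) 1 +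
        fderiv ℝ (u p.1) p.2 (EuclideanSpace.single 2 1) 2 = 0) →
      (∀ p ∈ U, ∀ b : Fin 3, b ≠ 2 →
        fderiv ℝ (u p.1) p.2 (EuclideanSpace.single 2 1) b = μ p.1 (p.2 2) * fderiv ℝ (u p.1) p.2 (EuclideanSpace.single b 1) 2) →
      (∀ p ∈ U,
        (1 - μ p.1 (p.2 2)) *
            (deriv (fun s => u s p.2 2) p.1 + fderiv ℝ (fun y => u p.1 y 2) p.2 (u p.1 p.2)
              - Δ (fun y => u p.1 y 2) p.2) =
          A p.1 (p.2 2) + (deriv (fun s => μ s (p.2 2)) p.1 - deriv (deriv (μ p.1)) (p.2 2)) * u p.1 p.2 2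
            + deriv (μ p.1) (p.2 2) / 2 * u p.1 p.2 2 ^ 2 - 2 * deriv (μ p.1) (p.2 2) * fderiv ℝ (u p.1) p.2 (EuclideanSpace.single 2 1) 2) →
      fderiv ℝ (fun y => fderiv ℝ (u p₀.1) y (EuclideanSpace.single 2 1) 2) p₀.2 (EuclideanSpace.single 0 1) *
            fderiv ℝ (u p₀.1) p₀.2 (EuclideanSpace.single 1 1) 2 -
          fderiv ℝ (fun y => fderiv ℝ (u p₀.1) y (EuclideanSpace.single 2 1) 2) p₀.2 (EuclideanSpace.single 1 1) *
            fderiv ℝ (u p₀.1) p₀.2 (EuclideanSpace.single 0 1) 2 ≠ 0 →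
      μ p₀.1 (p₀.2 2) ≠ 0 → μ p₀.1 (p₀.2 2) ≠ 1 → deriv (μ p₀.1) (p₀.2 2) ≠ 0 → μ p₀.1 (p₀.2 2) < 0 →
      (fderiv ℝ (u p₀.1) p₀.2 (EuclideanSpace.single 0 1) 0 ≠ fderiv ℝ (u p₀.1) p₀.2 (EuclideanSpace.single 1 1) 1 ∨
        fderiv ℝ (u p₀.1) p₀.2 (EuclideanSpace.single 1 1) 0 ≠ 0) →
      u p₀.1 p₀.2 = 0 → fderiv ℝ (u p₀.1) p₀.2 (EuclideanSpace.single 0 1) 2 = 0 → fderiv ℝ (u p₀.1) p₀.2 (EuclideanSpace.single 1 1) 2 = 1 → False :=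
  localTHEmptyHypNUGRS_of_comoving fun _ _ _ _ _ hU hp₀ hu hμ hA hpol hdiv hsh hE htw hm0 hm1 hmz _ hNU hrest _ _ hline =>
    LocalDatumZ.false_of_leaf (thSliceLocalDatumZC hU hp₀ hu hμ hA hpol hdiv hsh hE htw hm0 hm1 hmz hNU hrest hline) hcheck

/-- **The same FROM ONE LEAF GAUGED BY THE CO-MOVING RS DATA** (`leafCheckZV`: substitute `Iw_1_0 ↦ −1/2`, then every remaining term of `law_k − pins^e`
contains a letter of `sliceGaugeZerosRSC`). [folklore] -/
theorem localTHEmptyHypNUGRS_of_sliceLeafZVC (steps : List (List (QMvPoly × ℕ × List ℕ))) (k : ℕ) (e : List ℕ)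
    (hcheck : leafCheckZV sliceRelabel.m sliceRelabel.Sf sliceRelabel.Mf sliceRelabel.hyps' sliceRelabel.pins' sliceGaugeZerosRSC sliceGaugeValsRS
      steps k e = true) :
    ∀ (u : ℝ → EuclideanSpace ℝ (Fin 3) → EuclideanSpace ℝ (Fin 3)) (μ A : ℝ → ℝ → ℝ)
      (U : Set (ℝ × EuclideanSpace ℝ (Fin 3))) (p₀ : ℝ × EuclideanSpace ℝ (Fin 3)),
      IsOpen U → p₀ ∈ U → AnalyticOnNhd ℝ (Function.uncurry u) U →
      (∀ p ∈ U, AnalyticAt ℝ (Function.uncurry μ) (p.1, p.2 2)) → (∀ p ∈ U, AnalyticAt ℝ (Function.uncurry A) (p.1, p.2 2)) →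
      (∀ p ∈ U, fderiv ℝ (u p.1) p.2 (EuclideanSpace.single 0 1) 1 = fderiv ℝ (u p.1) p.2 (EuclideanSpace.single 1 1) 0) →
      (∀ p ∈ U, fderiv ℝ (u p.1) p.2 (EuclideanSpace.single 0 1) 0 + fderiv ℝ (u p.1) p.2 (EuclideanSpace.single 1 1) 1 +
        fderiv ℝ (u p.1) p.2 (EuclideanSpace.single 2 1) 2 = 0) →
      (∀ p ∈ U, ∀ b : Fin 3, b ≠ 2 →
        fderiv ℝ (u p.1) p.2 (EuclideanSpace.single 2 1) b = μ p.1 (p.2 2) * fderiv ℝ (u p.1) p.2 (EuclideanSpace.single b 1) 2) →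
      (∀ p ∈ U,
        (1 - μ p.1 (p.2 2)) *
            (deriv (fun s => u s p.2 2) p.1 + fderiv ℝ (fun y => u p.1 y 2) p.2 (u p.1 p.2)
              - Δ (fun y => u p.1 y 2) p.2) =
          A p.1 (p.2 2) + (deriv (fun s => μ s (p.2 2)) p.1 - deriv (deriv (μ p.1)) (p.2 2)) * u p.1 p.2 2
            + deriv (μ p.1) (p.2 2) / 2 * u p.1 p.2 2 ^ 2 - 2 * deriv (μ p.1) (p.2 2) * fderiv ℝ (u p.1) p.2 (EuclideanSpace.single 2 1) 2) →
      fderiv ℝ (fun y => fderiv ℝ (u p₀.1) y (EuclideanSpace.single 2 1) 2) p₀.2 (EuclideanSpace.single 0 1) *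
            fderiv ℝ (u p₀.1) p₀.2 (EuclideanSpace.single 1 1) 2 -
          fderiv ℝ (fun y => fderiv ℝ (u p₀.1) y (EuclideanSpace.single 2 1) 2) p₀.2 (EuclideanSpace.single 1 1) *
            fderiv ℝ (u p₀.1) p₀.2 (EuclideanSpace.single 0 1) 2 ≠ 0 →
      μ p₀.1 (p₀.2 2) ≠ 0 → μ p₀.1 (p₀.2 2) ≠ 1 → deriv (μ p₀.1) (p₀.2 2) ≠ 0 → μ p₀.1 (p₀.2 2) < 0 →
      (fderiv ℝ (u p₀.1) p₀.2 (EuclideanSpace.single 0 1) 0 ≠ fderiv ℝ (u p₀.1) p₀.2 (EuclideanSpace.single 1 1) 1 ∨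
        fderiv ℝ (u p₀.1) p₀.2 (EuclideanSpace.single 1 1) 0 ≠ 0) →
      u p₀.1 p₀.2 = 0 → fderiv ℝ (u p₀.1) p₀.2 (EuclideanSpace.single 0 1) 2 = 0 → fderiv ℝ (u p₀.1) p₀.2 (EuclideanSpace.single 1 1) 2 = 1 → False :=
  localTHEmptyHypNUGRS_of_comoving fun _ _ _ _ _ hU hp₀ hu hμ hA hpol hdiv hsh hE htw hm0 hm1 hmz _ hNU hrest hx0 hy1 hline =>
    LocalDatumZV.false_of_leaf (thSliceLocalDatumZVC hU hp₀ hu hμ hA hpol hdiv hsh hE htw hm0 hm1 hmz hNU hrest hx0 hy1 hline) hcheck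

/-- **The same FROM ONE SPLIT-FREE CHAIN GAUGED BY THE CO-MOVING GALILEAN ZEROS** (items = chunks / cancellations certified against `E'` extended by the earlier
items' laws — e.g. the static rows, their time derivatives along direction `0`, the LEAD's dynamic rows — then the gauged leaf; `…JetCertGaugeCancel.gaugedChainCheck`).
[folklore] -/
theorem localTHEmptyHypNUGRS_of_sliceChainZC (items : List ChainItem) (steps : List (List (QMvPoly × ℕ × List ℕ))) (k : ℕ) (e : List ℕ)
    (hcheck : gaugedChainCheck sliceRelabel.m sliceRelabel.Sf sliceRelabel.Mf sliceRelabel.pins' sliceGaugeZerosC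
      sliceRelabel.hyps' items steps k e = true) :
    ∀ (u : ℝ → EuclideanSpace ℝ (Fin 3) → EuclideanSpace ℝ (Fin 3)) (μ A : ℝ → ℝ → ℝ)
      (U : Set (ℝ × EuclideanSpace ℝ (Fin 3))) (p₀ : ℝ × EuclideanSpace ℝ (Fin 3)),
      IsOpen U → p₀ ∈ U → AnalyticOnNhd ℝ (Function.uncurry u) U →
      (∀ p ∈ U, AnalyticAt ℝ (Function.uncurry μ) (p.1, p.2 2)) → (∀ p ∈ U, AnalyticAt ℝ (Function.uncurry A) (p.1, p.2 2)) →
      (∀ p ∈ U, fderiv ℝ (u p.1) p.2 (EuclideanSpace.single 0 1) 1 = fderiv ℝ (u p.1) p.2 (EuclideanSpace.single 1 1) 0) →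
      (∀ p ∈ U, fderiv ℝ (u p.1) p.2 (EuclideanSpace.single 0 1) 0 + fderiv ℝ (u p.1) p.2 (EuclideanSpace.single 1 1) 1 +
        fderiv ℝ (u p.1) p.2 (EuclideanSpace.single 2 1) 2 = 0) →
      (∀ p ∈ U, ∀ b : Fin 3, b ≠ 2 →
        fderiv ℝ (u p.1) p.2 (EuclideanSpace.single 2 1) b = μ p.1 (p.2 2) * fderiv ℝ (u p.1) p.2 (EuclideanSpace.single b 1) 2) →
      (∀ p ∈ U,
        (1 - μ p.1 (p.2 2)) *
            (deriv (fun s => u s p.2 2) p.1 + fderiv ℝ (fun y => u p.1 y 2) p.2 (u p.1 p.2)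
              - Δ (fun y => u p.1 y 2) p.2) =
          A p.1 (p.2 2) + (deriv (fun s => μ s (p.2 2)) p.1 - deriv (deriv (μ p.1)) (p.2 2)) * u p.1 p.2 2
            + deriv (μ p.1) (p.2 2) / 2 * u p.1 p.2 2 ^ 2 - 2 * deriv (μ p.1) (p.2 2) * fderiv ℝ (u p.1) p.2 (EuclideanSpace.single 2 1) 2) →
      fderiv ℝ (fun y => fderiv ℝ (u p₀.1) y (EuclideanSpace.single 2 1) 2) p₀.2 (EuclideanSpace.single 0 1) *
            fderiv ℝ (u p₀.1) p₀.2 (EuclideanSpace.single 1 1) 2 -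
          fderiv ℝ (fun y => fderiv ℝ (u p₀.1) y (EuclideanSpace.single 2 1) 2) p₀.2 (EuclideanSpace.single 1 1) *
            fderiv ℝ (u p₀.1) p₀.2 (EuclideanSpace.single 0 1) 2 ≠ 0 →
      μ p₀.1 (p₀.2 2) ≠ 0 → μ p₀.1 (p₀.2 2) ≠ 1 → deriv (μ p₀.1) (p₀.2 2) ≠ 0 → μ p₀.1 (p₀.2 2) < 0 →
      (fderiv ℝ (u p₀.1) p₀.2 (EuclideanSpace.single 0 1) 0 ≠ fderiv ℝ (u p₀.1) p₀.2 (EuclideanSpace.single 1 1) 1 ∨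
        fderiv ℝ (u p₀.1) p₀.2 (EuclideanSpace.single 1 1) 0 ≠ 0) →
      u p₀.1 p₀.2 = 0 → fderiv ℝ (u p₀.1) p₀.2 (EuclideanSpace.single 0 1) 2 = 0 → fderiv ℝ (u p₀.1) p₀.2 (EuclideanSpace.single 1 1) 2 = 1 → False :=
  localTHEmptyHypNUGRS_of_comoving fun _ _ _ _ _ hU hp₀ hu hμ hA hpol hdiv hsh hE htw hm0 hm1 hmz _ hNU hrest _ _ hline =>
    LocalDatumZ.false_of_gaugedChain items _ steps k e hcheck
      (thSliceLocalDatumZC hU hp₀ hu hμ hA hpol hdiv hsh hE htw hm0 hm1 hmz hNU hrest hline)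

/-- **The same FROM ONE SPLIT-FREE CHAIN GAUGED BY THE CO-MOVING RS DATA** (`…JetCertGaugeVCancel.gaugedChainCheckV`). [folklore] -/
theorem localTHEmptyHypNUGRS_of_sliceChainZVC (items : List ChainItem) (steps : List (List (QMvPoly × ℕ × List ℕ))) (k : ℕ) (e : List ℕ)
    (hcheck : gaugedChainCheckV sliceRelabel.m sliceRelabel.Sf sliceRelabel.Mf sliceRelabel.pins' sliceGaugeZerosRSC sliceGaugeValsRS
      sliceRelabel.hyps' items steps k e = true) :
    ∀ (u : ℝ → EuclideanSpace ℝ (Fin 3) → EuclideanSpace ℝ (Fin 3)) (μ A : ℝ → ℝ → ℝ)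
      (U : Set (ℝ × EuclideanSpace ℝ (Fin 3))) (p₀ : ℝ × EuclideanSpace ℝ (Fin 3)),
      IsOpen U → p₀ ∈ U → AnalyticOnNhd ℝ (Function.uncurry u) U →
      (∀ p ∈ U, AnalyticAt ℝ (Function.uncurry μ) (p.1, p.2 2)) → (∀ p ∈ U, AnalyticAt ℝ (Function.uncurry A) (p.1, p.2 2)) →
      (∀ p ∈ U, fderiv ℝ (u p.1) p.2 (EuclideanSpace.single 0 1) 1 = fderiv ℝ (u p.1) p.2 (EuclideanSpace.single 1 1) 0) →
      (∀ p ∈ U, fderiv ℝ (u p.1) p.2 (EuclideanSpace.single 0 1) 0 + fderiv ℝ (u p.1) p.2 (EuclideanSpace.single 1 1) 1 +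
        fderiv ℝ (u p.1) p.2 (EuclideanSpace.single 2 1) 2 = 0) →
      (∀ p ∈ U, ∀ b : Fin 3, b ≠ 2 →
        fderiv ℝ (u p.1) p.2 (EuclideanSpace.single 2 1) b = μ p.1 (p.2 2) * fderiv ℝ (u p.1) p.2 (EuclideanSpace.single b 1) 2) →
      (∀ p ∈ U,
        (1 - μ p.1 (p.2 2)) *
            (deriv (fun s => u s p.2 2) p.1 + fderiv ℝ (fun y => u p.1 y 2) p.2 (u p.1 p.2)
              - Δ (fun y => u p.1 y 2) p.2) =
          A p.1 (p.2 2) + (deriv (fun s => μ s (p.2 2)) p.1 - deriv (deriv (μ p.1)) (p.2 2)) * u p.1 p.2 2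
            + deriv (μ p.1) (p.2 2) / 2 * u p.1 p.2 2 ^ 2 - 2 * deriv (μ p.1) (p.2 2) * fderiv ℝ (u p.1) p.2 (EuclideanSpace.single 2 1) 2) →
      fderiv ℝ (fun y => fderiv ℝ (u p₀.1) y (EuclideanSpace.single 2 1) 2) p₀.2 (EuclideanSpace.single 0 1) *
            fderiv ℝ (u p₀.1) p₀.2 (EuclideanSpace.single 1 1) 2 -
          fderiv ℝ (fun y => fderiv ℝ (u p₀.1) y (EuclideanSpace.single 2 1) 2) p₀.2 (EuclideanSpace.single 1 1) *
            fderiv ℝ (u p₀.1) p₀.2 (EuclideanSpace.single 0 1) 2 ≠ 0 →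
      μ p₀.1 (p₀.2 2) ≠ 0 → μ p₀.1 (p₀.2 2) ≠ 1 → deriv (μ p₀.1) (p₀.2 2) ≠ 0 → μ p₀.1 (p₀.2 2) < 0 →
      (fderiv ℝ (u p₀.1) p₀.2 (EuclideanSpace.single 0 1) 0 ≠ fderiv ℝ (u p₀.1) p₀.2 (EuclideanSpace.single 1 1) 1 ∨
        fderiv ℝ (u p₀.1) p₀.2 (EuclideanSpace.single 1 1) 0 ≠ 0) →
      u p₀.1 p₀.2 = 0 → fderiv ℝ (u p₀.1) p₀.2 (EuclideanSpace.single 0 1) 2 = 0 → fderiv ℝ (u p₀.1) p₀.2 (EuclideanSpace.single 1 1) 2 = 1 → False :=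
  localTHEmptyHypNUGRS_of_comoving fun _ _ _ _ _ hU hp₀ hu hμ hA hpol hdiv hsh hE htw hm0 hm1 hmz _ hNU hrest hx0 hy1 hline =>
    LocalDatumZV.false_of_gaugedChain items _ steps k e hcheck
      (thSliceLocalDatumZVC hU hp₀ hu hμ hA hpol hdiv hsh hE htw hm0 hm1 hmz hNU hrest hx0 hy1 hline)

end Summit.NavierStokesRegularity.NavierStokesRegularity.Theorems.PoloidalWindowDoorLrcModEntireTHCertSliceGaugeUD8TC

end
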